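import Literature.MathematicalPhysics.QuantumFieldTheory.YangMillsOS
import Literature.MathematicalPhysics.QuantumFieldTheory.SpeciesLatticeProducts
import Literature.MathematicalPhysics.QuantumFieldTheory.OSLorentzInvariance
import Literature.Analysis.FunctionSpaces.SchwartzComplete
import Literature.Analysis.FunctionSpaces.ContDiffHolderLocalization
import Summits.QuantumFields.YangMills.Theorems.ScalingWindowSplitCurvatureAmnesiaStubAngleCalculus
import Summits.QuantumFields.YangMills.Theorems.LangevinControlUVOSLegsFromFemtoAndGapStubUpgrade
import HarnessLib

/-!
# Uniformity of the lattice Ward functional in the rotation angle — preparatory lemmas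
# (stub `stub_uniformOfPointwise`, part 1 of 2)

Support file for the line `WardDefectSketch` of crux `CurvatureAmnesia` (item stmt-QuantumFields-16192, routes
`ScalingWindowSplit` / `CoincidenceRotationBootstrap`): the general lemmas behind the registered stub
`stub_uniformOfPointwise` ("pointwise Ward nullity on every separated real family ⇒ nullity uniform in the rotation
angle"), which is proved verbatim in `ScalingWindowSplitCurvatureAmnesiaStubUniformOfPointwise.lean` (part 2).
Pure proof file: no definitions, no notation.

* `exists_multilinearMap_latticeSchwinger` — the renormalised joint Wilson lattice `n`-point function
  `f ↦ latticeSchwinger r.ρ sch (·.F) k n σ f = ∫ ∏ⱼ Φⱼ(fⱼ)(Ũ) dμ_k` is a CONTINUOUS MULTILINEAR form in the `n` real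
  test functions: each smeared field `Φ(f)(U) = c a⁴ Σₓ f(a x)(O(τₓU) − m)` is linear in `f` and bounded by the `(0,0)`
  Schwartz seminorm (`abs_smearedLatticeField_le_seminorm`), Wilson's measure is a probability measure, and separate
  continuity upgrades to joint continuity on the Fréchet space `𝓢(ℝ⁴)ⁿ`
  (`Literature.Analysis.FunctionSpaces.MultilinearMap.continuous_of_continuous_update_schwartz`, Rudin Thm 2.17);
* `exists_tendsto_latticeSchwinger_of_tie` — under the lattice TIE (convergence on off-diagonal real tensors, `n ≠ 0`)
  the lattice `n`-point functions converge on every real family with pairwise disjoint supports (its tensor `⊗ gᵢ`,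
  `SchwartzMap.tensorFin`, is off-diagonal: `isOffDiagonal_of_disjoint_tsupport`);
* `linActTest_rotGen_comm` — the generator `L = x₁∂₀ − x₀∂₁` commutes with the `(x₀,x₁)`-rotations `ρ_θ = planeRot 0 θ`
  it generates: `(L g) ∘ ρ_θ⁻¹ = L (g ∘ ρ_θ⁻¹)` (chain rule);
* `stub_uniformOfPointwise_cutoffFrame` — LOCAL FRAMES (registered sub-goal): for a separated real family `f` and an angle `θ₀`, the rotated supports
  `ρ_θ(tsupport fⱼ)` stay, for `θ` near `θ₀`, inside fixed pairwise disjoint neighbourhoods of the compacts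
  `ρ_{θ₀}(tsupport fⱼ)` on which smooth compactly supported cutoffs `χⱼ ≡ 1`; hence `χⱼ · fⱼ^θ = fⱼ^θ`
  (disjoint neighbourhood filters of disjoint compacts, the smooth Urysohn lemma
  `Literature.Analysis.FunctionSpaces.exists_contDiff_one_nhdsSet_of_isCompact`, and the tube lemma);
* `continuous_rho_symm_toContinuousLinearMap`, `tsupport_linActTest`, `tsupport_rotGen_subset` — orbit and support
  bookkeeping for the rotated test functions `linActTest (planeRot 0 θ) g = g ∘ ρ_θ⁻¹`.

References: folklore (W. Rudin, *Functional Analysis*, 2nd ed., Thm 2.17; N. Bourbaki, *EVT* III §5;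
L. Hörmander, *ALPDO I*, Thm 1.4.1 for smooth cutoffs).
-/

noncomputable section

namespace Summit.QuantumFields.YangMills.Cruxes.CurvatureAmnesia.WardDefect

open scoped SchwartzMap BigOperators Topology
open MeasureTheory Filter Literature.MathematicalPhysics.QuantumLattice Literature.MathematicalPhysics.AQFT
  Literature.MathematicalPhysics.QuantumFieldTheory
open Summit.QuantumFields.YangMills.Theorems.OSLegsFromFemtoAndGap.Upgrade (rho_symm_apply)
open Literature.Probability.LatticeModels (box)

section Lattice

variable {G : Type} [MeasurableSpace G]

/-- The smeared lattice field is additive in the test function. [folklore] -/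
theorem smearedLatticeField_add (O : LGConfig 4 G → ℝ)
    (Λ : Finset (Literature.Probability.LatticeModels.Site 4)) (a c m : ℝ)
    (f g : 𝓢(EuclideanSpace ℝ (Fin 4), ℝ)) (V : LGConfig 4 G) :
    smearedLatticeField O Λ a c m (f + g) V =
      smearedLatticeField O Λ a c m f V + smearedLatticeField O Λ a c m g V := by
  simp only [smearedLatticeField, add_apply, add_mul, Finset.sum_add_distrib, mul_add]

/-- The smeared lattice field is homogeneous in the test function. [folklore] -/
theorem smearedLatticeField_smul (O : LGConfig 4 G → ℝ)
    (Λ : Finset (Literature.Probability.LatticeModels.Site 4)) (a c m t : ℝ)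
    (f : 𝓢(EuclideanSpace ℝ (Fin 4), ℝ)) (V : LGConfig 4 G) :
    smearedLatticeField O Λ a c m (t • f) V = t * smearedLatticeField O Λ a c m f V := by
  simp only [smearedLatticeField, smul_apply, smul_eq_mul, Finset.mul_sum]
  exact Finset.sum_congr rfl fun x _ => by ring

/-- **Seminorm bound**: `|Φ(f)(V)| ≤ C · p₀₀(f)` uniformly in the configuration. [folklore] -/
theorem abs_smearedLatticeField_le_seminorm {O : LGConfig 4 G → ℝ} {C : ℝ} (hC : ∀ U, |O U| ≤ C)
    (Λ : Finset (Literature.Probability.LatticeModels.Site 4)) (a c m : ℝ)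
    (f : 𝓢(EuclideanSpace ℝ (Fin 4), ℝ)) (V : LGConfig 4 G) :
    |smearedLatticeField O Λ a c m f V| ≤
      (|c * a ^ 4| * ∑ _x ∈ Λ, (C + |m|)) * SchwartzMap.seminorm ℝ 0 0 f := by
  unfold smearedLatticeField
  rw [abs_mul, mul_assoc, Finset.sum_mul]
  refine mul_le_mul_of_nonneg_left ((Finset.abs_sum_le_sum_abs _ _).trans
    (Finset.sum_le_sum fun x _ => ?_)) (abs_nonneg _)
  rw [abs_mul, mul_comm]
  refine mul_le_mul ((abs_sub _ _).trans (add_le_add (hC _) le_rfl)) ?_ (abs_nonneg _)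
    ((abs_nonneg _).trans (hC (configShift (-x) V)) |>.trans (le_add_of_nonneg_right (abs_nonneg _)))
  rw [← Real.norm_eq_abs]
  exact SchwartzMap.norm_le_seminorm ℝ f _

variable [Group G] [TopologicalSpace G] [IsTopologicalGroup G] [CompactSpace G] [BorelSpace G]

/-- **The joint lattice `n`-point function is a continuous multilinear form** in the `n` real test functions
(each smeared field is a finite linear combination of point evaluations, bounded by the `(0,0)` Schwartz
seminorm; Wilson's measure is a probability measure). [folklore] -/
theorem exists_multilinearMap_latticeSchwinger (r : LatticeRep G) (sch : SpeciesScheme (YMSpecies G))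
    (k : ℕ) {n : ℕ} (σ : Fin n → YMSpecies G) :
    ∃ T : MultilinearMap ℝ (fun _ : Fin n => 𝓢(EuclideanSpace ℝ (Fin 4), ℝ)) ℝ, Continuous T ∧
      ∀ f, T f = latticeSchwinger r.ρ sch (fun s => s.F) k n σ f := by
  haveI := isProbabilityMeasure_wilsonMeasure (d := 4) (L := sch.side k) r.ρ r.continuous (sch.β k)
  set μ : Measure (GaugeConfig 4 (sch.side k) G) := wilsonMeasure (d := 4) (L := sch.side k) r.ρ (sch.β k)
    with hμ
  -- the one-slot factorisation of the integrand and its integrability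
  set Φ : Fin n → 𝓢(EuclideanSpace ℝ (Fin 4), ℝ) → GaugeConfig 4 (sch.side k) G → ℝ := fun j φ U =>
    smearedLatticeField (σ j).F (box 4 (sch.L k)) (sch.a k) (sch.c (σ j) k) (sch.m (σ j) k) φ
      (torusLift (sch.side k) U) with hΦ
  have hLS : ∀ f, latticeSchwinger r.ρ sch (fun s => s.F) k n σ f = ∫ U, obsProd sch k σ f U ∂μ :=
    fun f => rfl
  have hint : ∀ f, Integrable (obsProd sch k σ f) μ := fun f => by
    obtain ⟨B, hB⟩ := exists_bound_obsProd sch k σ f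
    exact Integrable.of_bound (measurable_obsProd sch k σ f).aestronglyMeasurable B
      (Eventually.of_forall fun U => by rw [Real.norm_eq_abs]; exact hB U)
  have hupd : ∀ [DecidableEq (Fin n)] (f : Fin n → 𝓢(EuclideanSpace ℝ (Fin 4), ℝ)) (i : Fin n)
      (z : 𝓢(EuclideanSpace ℝ (Fin 4), ℝ)) (U : GaugeConfig 4 (sch.side k) G),
      obsProd sch k σ (Function.update f i z) U = Φ i z U * ∏ j ∈ Finset.univ.erase i, Φ j (f j) U := by
    intro _ f i z U
    exact prod_apply_update_eq (fun j φ => Φ j φ U) f i z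
  obtain ⟨T₀, hT₀⟩ : ∃ T : MultilinearMap ℝ (fun _ : Fin n => 𝓢(EuclideanSpace ℝ (Fin 4), ℝ)) ℝ,
      ∀ f, T f = latticeSchwinger r.ρ sch (fun s => s.F) k n σ f :=
    ⟨{ toFun := fun f => latticeSchwinger r.ρ sch (fun s => s.F) k n σ f,
       map_update_add' := fun f i x y => by
         simp only [hLS]
         rw [← integral_add (hint _) (hint _)]
         refine integral_congr_ae (Eventually.of_forall fun U => ?_)
         simp only [hupd, hΦ, smearedLatticeField_add, add_mul]
       map_update_smul' := fun f i t x => by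
         simp only [hLS]
         rw [smul_eq_mul, ← integral_const_mul]
         refine integral_congr_ae (Eventually.of_forall fun U => ?_)
         simp only [hupd, hΦ, smearedLatticeField_smul, mul_assoc] }, fun f => rfl⟩
  refine ⟨T₀, ?_, hT₀⟩
  -- joint continuity from continuity in each slot
  refine Literature.Analysis.FunctionSpaces.MultilinearMap.continuous_of_continuous_update_schwartz
    (𝕜 := ℝ) _ fun f i => ?_
  classical
  -- the slot map is linear and bounded by the `(0,0)` seminorm
  obtain ⟨C₀, hC₀⟩ := (σ i).bounded
  have hC : ∀ U, |(σ i).F U| ≤ |C₀| := fun U => (hC₀ U).trans (le_abs_self _)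
  choose B hB using fun j => exists_bound_smearedLatticeField (σ j).bounded (box 4 (sch.L k)) (sch.a k)
    (sch.c (σ j) k) (sch.m (σ j) k) (f j)
  set K : ℝ := (|sch.c (σ i) k * sch.a k ^ 4| * ∑ _x ∈ box 4 (sch.L k), (|C₀| + |sch.m (σ i) k|)) *
    ∏ j ∈ Finset.univ.erase i, |B j| with hK
  have hK0 : 0 ≤ K := by positivity
  have hbound : ∀ g, |T₀ (Function.update f i g)| ≤ K * SchwartzMap.seminorm ℝ 0 0 g := fun g => by
    rw [hT₀, hLS, ← Real.norm_eq_abs]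
    refine (norm_integral_le_of_norm_le_const (C := K * SchwartzMap.seminorm ℝ 0 0 g)
      (Eventually.of_forall fun U => ?_)).trans (by rw [probReal_univ, mul_one])
    rw [Real.norm_eq_abs, hupd, abs_mul, hK, mul_right_comm, Finset.abs_prod]
    exact mul_le_mul (abs_smearedLatticeField_le_seminorm hC _ _ _ _ _ _)
      (Finset.prod_le_prod (fun j _ => abs_nonneg _) fun j _ => (hB j _).trans (le_abs_self _))
      (Finset.prod_nonneg fun j _ => abs_nonneg _) (by positivity)
  exact (SchwartzMap.mkCLMtoNormedSpace (𝕜 := ℝ) (𝕜' := ℝ) (σ := RingHom.id ℝ)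
    (fun g => T₀ (Function.update f i g))
    (fun g g' => (T₀.toLinearMap f i).map_add g g') (fun t g => (T₀.toLinearMap f i).map_smul t g)
    ⟨{((0 : ℕ), (0 : ℕ))}, K, hK0, fun g => by
      rw [Finset.sup_singleton, Real.norm_eq_abs]
      exact hbound g⟩).continuous

/-- **Separated real tensors are off-diagonal**: the topological support of `⊗ gᵢ` lies in `∏ tsupport gᵢ`,
which misses the coincidence locus when the supports are pairwise disjoint. [folklore] -/
theorem isOffDiagonal_of_disjoint_tsupport {n : ℕ} {g : Fin n → 𝓢(EuclideanSpace ℝ (Fin 4), ℝ)}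
    (hd : ∀ i j, i ≠ j → Disjoint (tsupport (g i : EuclideanSpace ℝ (Fin 4) → ℝ))
      (tsupport (g j : EuclideanSpace ℝ (Fin 4) → ℝ)))
    {F : 𝓢((Fin n → EuclideanSpace ℝ (Fin 4)), ℂ)} (hF : IsTensorOf F fun i => ofRealTest (g i)) :
    IsOffDiagonal F := by
  have hsub : closure (Function.support (F : (Fin n → EuclideanSpace ℝ (Fin 4)) → ℂ)) ⊆
      ⋂ i, (fun x : Fin n → EuclideanSpace ℝ (Fin 4) => x i) ⁻¹'
        tsupport (g i : EuclideanSpace ℝ (Fin 4) → ℝ) :=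
    closure_minimal
      (fun y hy => Set.mem_iInter.2 fun i => subset_tsupport _ (by
        rw [Function.mem_support] at hy ⊢
        intro h0
        refine hy ?_
        rw [hF y]
        exact Finset.prod_eq_zero (Finset.mem_univ i)
          (by show ((g i (y i) : ℝ) : ℂ) = 0; rw [h0, Complex.ofReal_zero])))
      (isClosed_iInter fun i => (isClosed_tsupport _).preimage (continuous_apply i))
  refine IsOffDiagonal.of_tsupport_subset ?_
  intro x hx hxD
  obtain ⟨i, j, hij, hxij⟩ := hxD
  have hi : x i ∈ tsupport (g i : EuclideanSpace ℝ (Fin 4) → ℝ) := Set.mem_iInter.1 (hsub hx) i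
  have hj : x j ∈ tsupport (g j : EuclideanSpace ℝ (Fin 4) → ℝ) := Set.mem_iInter.1 (hsub hx) j
  rw [hxij] at hi
  exact Set.disjoint_left.1 (hd i j hij) hi hj

/-- **The lattice tie gives convergence on separated real families**: if the complexified lattice `n`-point
functions converge on off-diagonal real tensors (`n ≠ 0`), then `latticeSchwinger … g` converges for every real
family with pairwise disjoint supports (test it on the tensor `⊗ gᵢ`). [folklore] -/
theorem exists_tendsto_latticeSchwinger_of_tie (r : LatticeRep G) (sch : SpeciesScheme (YMSpecies G))
    (S : LabelledSchwingerFamily (YMSpecies G) (EuclideanSpace ℝ (Fin 4)))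
    (hTie : ∀ (n : ℕ), n ≠ 0 → ∀ (σ : Fin n → YMSpecies G) (f : Fin n → 𝓢(EuclideanSpace ℝ (Fin 4), ℝ))
      (F : 𝓢((Fin n → EuclideanSpace ℝ (Fin 4)), ℂ)),
      IsTensorOf F (fun i => ofRealTest (f i)) → IsOffDiagonal F →
        Tendsto (fun k : ℕ => ((latticeSchwinger r.ρ sch (fun s => s.F) k n σ f : ℝ) : ℂ)) atTop
          (𝓝 (S n σ F)))
    {n : ℕ} (hn : n ≠ 0) (σ : Fin n → YMSpecies G) {g : Fin n → 𝓢(EuclideanSpace ℝ (Fin 4), ℝ)}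
    (hd : ∀ i j, i ≠ j → Disjoint (tsupport (g i : EuclideanSpace ℝ (Fin 4) → ℝ))
      (tsupport (g j : EuclideanSpace ℝ (Fin 4) → ℝ))) :
    ∃ c : ℝ, Tendsto (fun k : ℕ => latticeSchwinger r.ρ sch (fun s => s.F) k n σ g) atTop (𝓝 c) := by
  set F := SchwartzMap.tensorFin n (fun i => ofRealTest (g i)) with hF
  have h := hTie n hn σ g F (isTensorOf_tensorFin _) (isOffDiagonal_of_disjoint_tsupport hd
    (isTensorOf_tensorFin _))
  refine ⟨(S n σ F).re, ?_⟩
  have h' := (Complex.continuous_re.tendsto _).comp h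
  simpa only [Function.comp_def, Complex.ofReal_re] using h'

end Lattice

/-! ### The rotation generator commutes with the rotations it generates -/

/-- `(L g) ∘ ρ_θ⁻¹ = L (g ∘ ρ_θ⁻¹)` for the generator `L = x₁∂₀ − x₀∂₁` of the `(x₀,x₁)`-rotations `ρ_θ`. [folklore] -/
theorem linActTest_rotGen_comm (θ : ℝ) (g : 𝓢(EuclideanSpace ℝ (Fin 4), ℝ)) :
    linActTest (planeRot (d := 3) 0 θ)
        (SchwartzMap.smulLeftCLM ℝ (fun x : EuclideanSpace ℝ (Fin 4) => x 1)
            (LineDeriv.lineDerivOp (EuclideanSpace.single (0 : Fin 4) (1 : ℝ) : EuclideanSpace ℝ (Fin 4)) g) -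
          SchwartzMap.smulLeftCLM ℝ (fun x : EuclideanSpace ℝ (Fin 4) => x 0)
            (LineDeriv.lineDerivOp (EuclideanSpace.single (1 : Fin 4) (1 : ℝ) : EuclideanSpace ℝ (Fin 4)) g)) =
      SchwartzMap.smulLeftCLM ℝ (fun x : EuclideanSpace ℝ (Fin 4) => x 1)
          (LineDeriv.lineDerivOp (EuclideanSpace.single (0 : Fin 4) (1 : ℝ) : EuclideanSpace ℝ (Fin 4))
            (linActTest (planeRot (d := 3) 0 θ) g)) -
        SchwartzMap.smulLeftCLM ℝ (fun x : EuclideanSpace ℝ (Fin 4) => x 0)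
          (LineDeriv.lineDerivOp (EuclideanSpace.single (1 : Fin 4) (1 : ℝ) : EuclideanSpace ℝ (Fin 4))
            (linActTest (planeRot (d := 3) 0 θ) g)) := by
  have h0 : Function.HasTemperateGrowth (fun x : EuclideanSpace ℝ (Fin 4) => x 0) :=
    (EuclideanSpace.proj (0 : Fin 4) : EuclideanSpace ℝ (Fin 4) →L[ℝ] ℝ).hasTemperateGrowth
  have h1 : Function.HasTemperateGrowth (fun x : EuclideanSpace ℝ (Fin 4) => x 1) :=
    (EuclideanSpace.proj (1 : Fin 4) : EuclideanSpace ℝ (Fin 4) →L[ℝ] ℝ).hasTemperateGrowth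
  have hcoe : ((linActTest (planeRot (d := 3) 0 θ) g : 𝓢(EuclideanSpace ℝ (Fin 4), ℝ)) :
      EuclideanSpace ℝ (Fin 4) → ℝ) = (g : EuclideanSpace ℝ (Fin 4) → ℝ) ∘
        ⇑((planeRot (d := 3) 0 θ).symm.toContinuousLinearEquiv :
          EuclideanSpace ℝ (Fin 4) ≃L[ℝ] EuclideanSpace ℝ (Fin 4)) := rfl
  ext x
  simp only [sub_apply, SchwartzMap.smulLeftCLM_apply_apply h0,
    SchwartzMap.smulLeftCLM_apply_apply h1, linActTest_apply, SchwartzMap.lineDerivOp_apply_eq_fderiv,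
    smul_eq_mul]
  rw [hcoe, ContinuousLinearEquiv.comp_right_fderiv]
  simp only [ContinuousLinearMap.comp_apply, ContinuousLinearEquiv.coe_coe,
    LinearIsometryEquiv.coe_toContinuousLinearEquiv, rho_symm_apply,
    Summit.QuantumFields.YangMills.Theorems.OSLegsFromFemtoAndGap.Upgrade.rho_e0,
    Summit.QuantumFields.YangMills.Theorems.OSLegsFromFemtoAndGap.Upgrade.rho_e1, map_add, map_smul,
    smul_eq_mul, planeRot_apply, Real.cos_neg, Real.sin_neg]
  simp
  ring

/-! ### Local frames: cutoffs adapted to the rotated supports near a fixed angle -/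

/-- **Local frame** (registered sub-goal `stub_uniformOfPointwise_cutoffFrame` of the stub `stub_uniformOfPointwise`).  For a real
family with compact, pairwise disjoint supports and an angle `θ₀` there are smooth compactly supported cutoffs `χⱼ` of
temperate growth with pairwise disjoint supports such that `χⱼ · (fⱼ ∘ ρ_θ⁻¹) = fⱼ ∘ ρ_θ⁻¹` for every `j` and every `θ`
near `θ₀` (the rotated supports `ρ_θ(tsupport fⱼ)` stay inside fixed pairwise disjoint neighbourhoods of
`ρ_{θ₀}(tsupport fⱼ)`, on which `χⱼ = 1`). [folklore] -/
theorem stub_uniformOfPointwise_cutoffFrame :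
    ∀ {n : ℕ} (f : Fin n → 𝓢(EuclideanSpace ℝ (Fin 4), ℝ)),
      ((∀ i, HasCompactSupport (f i : EuclideanSpace ℝ (Fin 4) → ℝ)) ∧
        ∀ i j, i ≠ j → Disjoint (tsupport (f i : EuclideanSpace ℝ (Fin 4) → ℝ))
          (tsupport (f j : EuclideanSpace ℝ (Fin 4) → ℝ))) →
      ∀ θ₀ : ℝ, ∃ χ : Fin n → EuclideanSpace ℝ (Fin 4) → ℝ,
        (∀ j, (χ j).HasTemperateGrowth) ∧ (∀ j, HasCompactSupport (χ j)) ∧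
        (∀ i j, i ≠ j → Disjoint (tsupport (χ i)) (tsupport (χ j))) ∧
        ∀ᶠ θ in 𝓝 θ₀, ∀ j, SchwartzMap.smulLeftCLM ℝ (χ j) (linActTest (planeRot (0 : Fin 3) θ) (f j)) =
          linActTest (planeRot (0 : Fin 3) θ) (f j) := by
  intro n f hf θ₀
  set ρ₀ : EuclideanSpace ℝ (Fin 4) ≃ₗᵢ[ℝ] EuclideanSpace ℝ (Fin 4) := planeRot (d := 3) 0 θ₀ with hρ₀
  set K : Fin n → Set (EuclideanSpace ℝ (Fin 4)) := fun j => ρ₀ '' tsupport (f j : EuclideanSpace ℝ (Fin 4) → ℝ)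
    with hK
  have hKc : ∀ j, IsCompact (K j) := fun j => (hf.1 j).image ρ₀.continuous
  have hKd : Pairwise (Function.onFun Disjoint fun j => 𝓝ˢ (K j)) := fun i j hij =>
    disjoint_nhdsSet_nhdsSet (hKc i).isClosed (hKc j).isClosed
      ((Set.disjoint_image_iff ρ₀.injective).2 (hf.2 i j hij))
  obtain ⟨s, hs, hsd⟩ := hKd.exists_mem_filter_of_disjoint
  choose O hOo hKO hOs using fun j => mem_nhdsSet_iff_exists.1 (hs j)
  choose χ hχs hχc hχO hχ1 _hχ01 using fun j =>
    Literature.Analysis.FunctionSpaces.exists_contDiff_one_nhdsSet_of_isCompact (hKc j) (hOo j) (hKO j)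
  have htemp : ∀ j, (χ j).HasTemperateGrowth := fun j => (hχc j).hasTemperateGrowth (hχs j)
  refine ⟨χ, htemp, hχc, fun i j hij =>
    (hsd hij).mono ((hχO i).trans (hOs i)) ((hχO j).trans (hOs j)), ?_⟩
  choose W hWo hKW hW1 using fun j => mem_nhdsSet_iff_exists.1 (hχ1 j)
  have hcont : Continuous fun p : ℝ × EuclideanSpace ℝ (Fin 4) => planeRot (d := 3) 0 p.1 p.2 :=
    (continuous_apply (0 : Fin 1)).comp
      ((Summit.QuantumFields.YangMills.Theorems.OSLegsFromFemtoAndGap.Upgrade.continuous_rho_diag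
        (n := 1)).comp (continuous_fst.prodMk (continuous_pi fun _ => continuous_snd)))
  have hev : ∀ j, ∀ᶠ θ in 𝓝 θ₀, ∀ y ∈ tsupport (f j : EuclideanSpace ℝ (Fin 4) → ℝ),
      planeRot (d := 3) 0 θ y ∈ W j := fun j =>
    (hf.1 j).eventually_forall_of_forall_eventually fun y hy =>
      hcont.continuousAt.eventually_mem ((hWo j).mem_nhds (hKW j ⟨y, hy, rfl⟩))
  filter_upwards [eventually_all.2 hev] with θ hθ j
  ext x
  rw [SchwartzMap.smulLeftCLM_apply_apply (htemp j)]
  by_cases hx : x ∈ tsupport (linActTest (planeRot (d := 3) 0 θ) (f j) : EuclideanSpace ℝ (Fin 4) → ℝ)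
  · have hy : (planeRot (d := 3) 0 θ).symm x ∈ tsupport (f j : EuclideanSpace ℝ (Fin 4) → ℝ) :=
      tsupport_comp_subset_preimage (f j : EuclideanSpace ℝ (Fin 4) → ℝ)
        (planeRot (d := 3) 0 θ).symm.continuous hx
    have h1 := hθ j _ hy
    rw [LinearIsometryEquiv.apply_symm_apply] at h1
    rw [hW1 j h1, one_smul]
  · rw [image_eq_zero_of_notMem_tsupport hx, smul_zero]


/-! ### Orbits and supports of rotated test functions -/

/-- The plane rotation is jointly continuous in the angle and the point. [folklore] -/
theorem continuous_planeRot_uncurry :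
    Continuous fun p : ℝ × EuclideanSpace ℝ (Fin 4) => planeRot (d := 3) 0 p.1 p.2 :=
  (continuous_apply (0 : Fin 1)).comp
    ((Summit.QuantumFields.YangMills.Theorems.OSLegsFromFemtoAndGap.Upgrade.continuous_rho_diag
      (n := 1)).comp (continuous_fst.prodMk (continuous_pi fun _ => continuous_snd)))

/-- The inverse plane rotation `t ↦ (ρ_t)⁻¹`, as a continuous linear map of `ℝ⁴`, depends continuously on the
angle (operator-norm topology). [folklore] -/
theorem continuous_rho_symm_toContinuousLinearMap :
    Continuous fun t : ℝ => (((planeRot (d := 3) 0 t).symm.toContinuousLinearEquiv :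
      EuclideanSpace ℝ (Fin 4) ≃L[ℝ] EuclideanSpace ℝ (Fin 4)) :
        EuclideanSpace ℝ (Fin 4) →L[ℝ] EuclideanSpace ℝ (Fin 4)) := by
  refine continuous_clm_apply.2 fun y => ?_
  have h : (fun t : ℝ => (((planeRot (d := 3) 0 t).symm.toContinuousLinearEquiv :
      EuclideanSpace ℝ (Fin 4) ≃L[ℝ] EuclideanSpace ℝ (Fin 4)) :
        EuclideanSpace ℝ (Fin 4) →L[ℝ] EuclideanSpace ℝ (Fin 4)) y) =
      fun t => planeRot (d := 3) 0 (-t) y := by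
    funext t
    simp only [ContinuousLinearEquiv.coe_coe, LinearIsometryEquiv.coe_toContinuousLinearEquiv]
    exact rho_symm_apply t y
  rw [h]
  exact continuous_planeRot_uncurry.comp₂ continuous_neg continuous_const

/-- The support of a rotated test function is the rotated support. [folklore] -/
theorem tsupport_linActTest (R : EuclideanSpace ℝ (Fin 4) ≃ₗᵢ[ℝ] EuclideanSpace ℝ (Fin 4))
    (g : 𝓢(EuclideanSpace ℝ (Fin 4), ℝ)) :
    tsupport (linActTest R g : EuclideanSpace ℝ (Fin 4) → ℝ) = R '' tsupport (g : EuclideanSpace ℝ (Fin 4) → ℝ) := by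
  rw [R.image_eq_preimage_symm]
  exact tsupport_comp_eq_preimage (g : EuclideanSpace ℝ (Fin 4) → ℝ) R.symm.toHomeomorph

/-- Off the support of `g`, every `c · ∂_v g` vanishes. [folklore] -/
theorem smulLeftCLM_lineDerivOp_apply_eq_zero {g : 𝓢(EuclideanSpace ℝ (Fin 4), ℝ)} {x : EuclideanSpace ℝ (Fin 4)}
    (hx : x ∉ tsupport (g : EuclideanSpace ℝ (Fin 4) → ℝ)) (c : EuclideanSpace ℝ (Fin 4) → ℝ)
    (v : EuclideanSpace ℝ (Fin 4)) :
    SchwartzMap.smulLeftCLM ℝ c (LineDeriv.lineDerivOp v g) x = 0 :=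
  image_eq_zero_of_notMem_tsupport fun h =>
    hx (SchwartzMap.tsupport_lineDerivOp_subset v g ((SchwartzMap.tsupport_smulLeftCLM_subset c _ h).1))

/-- The generator `L = x₁∂₀ − x₀∂₁` does not enlarge supports. [folklore] -/
theorem tsupport_rotGen_subset (g : 𝓢(EuclideanSpace ℝ (Fin 4), ℝ)) :
    tsupport ((SchwartzMap.smulLeftCLM ℝ (fun x : EuclideanSpace ℝ (Fin 4) => x 1)
          (LineDeriv.lineDerivOp (EuclideanSpace.single (0 : Fin 4) (1 : ℝ) : EuclideanSpace ℝ (Fin 4)) g) -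
        SchwartzMap.smulLeftCLM ℝ (fun x : EuclideanSpace ℝ (Fin 4) => x 0)
          (LineDeriv.lineDerivOp (EuclideanSpace.single (1 : Fin 4) (1 : ℝ) : EuclideanSpace ℝ (Fin 4)) g) :
        𝓢(EuclideanSpace ℝ (Fin 4), ℝ)) : EuclideanSpace ℝ (Fin 4) → ℝ) ⊆
      tsupport (g : EuclideanSpace ℝ (Fin 4) → ℝ) := by
  refine closure_minimal ?_ (isClosed_tsupport _)
  intro x hx
  rw [Function.mem_support, sub_apply] at hx
  by_contra hx'
  rw [smulLeftCLM_lineDerivOp_apply_eq_zero hx', smulLeftCLM_lineDerivOp_apply_eq_zero hx', sub_zero] at hx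
  exact hx rfl

end Summit.QuantumFields.YangMills.Cruxes.CurvatureAmnesia.WardDefect

end
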